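import Summits.QuantumFields.BalabanUV.T4Continuum.Support.ShellMeasureLandauEndAssembledDecayCfLinCoTestsSchurCoarse
import Summits.QuantumFields.BalabanUV.T4Continuum.Support.ShellMeasureReadOutsMax

/-!
# `T4Continuum.ShellMeasureLandauEndAssembledDecayCfLinCoTestsSchurCoarseReadOuts`
# — ROW S109 f2, LINK (4) OF THE JUNCTION WAVE: the u-tuple's ABSTRACT carrier `𝒴` READ as the (19)∕(98) source space
# `WMax w w′ (covD Λu η U₀u)` on the block's fine bonds, the classifier letters := the four (Ad-twisted) lattice-angle read-outs
# of `∂p` — census rows R12∕R13 `hκ hℓ hlen hκc hcurl` DERIVED, `m := 4`, `κr := η∕w₀`, `κc := 2η²∕w₀′²`, the (SM) rows from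
# η-FREE numbers; conclusion IDENTICAL to link (3)'s
(cell `pub-balaban`, sub-cell `t4`, spine estimate NE7c (node U5b); NE7c ROUND-2 crew, unit
`b2b-balaban-t4-ne7c-formalise-leaf-08` gen 17; owner table `t4/b2b-balaban-t4-ne7c-p1/LEAVES-NE7c-P1.md` **ROW S109 «W-i READ-OUT
ROWS ON THE (19)∕(98) SOURCE SPACE»**, file f2 (RULING R-ne7cp1-g36-12 (4), journal l.22193: «f2 = the host wrapper over link (3)»;
OFFER l.21839, COLLISION NOTE l.22078, f1 `ShellMeasureReadOutsMax` p238765 ✓ XREAD ok leaf-05-g11 C-ne7cL05g11-5); ADDITIVE —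
imports LINK (3)
`ShellMeasureLandauEndAssembledDecayCfLinCoTestsSchurCoarse` (p239707, leaf-03-g9; the chain: (1) S108 f2
`…Schur` leaf-04-g11 → (2) S108 f3 `…SchurElb` leaf-07-g10 → (3) S110 `…Coarse`) and S109 f1 `ShellMeasureReadOutsMax` ONLY;
[folklore]; ONE theorem, 0 `def`, 0 `def … : Prop`, 0 sorry, 0 citation tags; the statement is GENERATED from link (3)'s tree bytes
(sha16 8e0e781581cdfb28) by `HOME/b2b-balaban-t4-ne7c-formalise-leaf-08/g17/gen_f2.py`
— every surviving binder passed to the host BY NAME, the conclusion COPIED VERBATIM)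

HONEST FRAMING.  Finite four-torus programme, rung (B)+1 only — NOT infinite volume, NOT a mass gap, NOT the Clay problem,
NOT summit progress; (B), `BetaPertHyp`, (B^μ) not consumed.  NE7c (`T4IndicatorShell.ShellWeightBound`) is NOT PRINTED
in [Balaban 1983–89] and NOT PROVED; «NE7c ⇐ the named binders» (trigger c3): every binder below is DISPLAYED, asserted by
nobody; (M1) realized ≠ NE7c.  THE OWNER's TWO SENTENCES (R-ne7cp1-g36-12 (4), verbatim): **(i) the u-tuple's remaining W-a
rows `h𝒢 hW hH₁ hH hι` are from now on DISPLAYED IN PRINT's (19)-NORM on the block — `max{|A|·(Lʲη), |∇^η_{U₀}A|·(Lʲη)²}`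
([Balaban1985Variational] p. 281 (19), S65 f2c `WMax`) — a SHARPENING OF THE READING, class T unchanged; this is
where [Balaban1985BackgroundPropagators] Thm 3.13 ∕ B11 Prop. 4 would have to be proved; (ii) NOTHING of B11 (19)–(37) is
discharged — the letters are OUR maps, their norms are arithmetic in OUR instance.**  Equation numbers LOCATE displayed shapes,
they are not citations.  HONEST DEPENDENCY (cell): continuum YM on T⁴ ⇐ BetaPertH ∧ nine spine estimates (0/9 proved);
BetaPertH ⇐ (D1) ∧ (D4) ∧ CAP+tail; G-an2-4 gates asym, D1 and NE2/3/4.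

WHAT IS PROVED ([folklore]).
**`slotAC_realized_su2_landauChart_assembled_decay_cfB7_lin_coTests_schur_elb_coarse_readOuts`**
= link (3)'s `slotAC_realized_su2_landauChart_assembled_decay_cfB7_lin_coTests_schur_elb_coarse`
(namespace `ShellMeasureLandauEndAssembledDecayCfLinCoTestsSchurCoarse`) BY NAME with:
* THE CARRIER READ: the host's implicit complete normed space `𝒴` := `ShellMeasureReadOutsMax.Ysp Λu η U₀u wu wu′` — S65 f2c's
  `WMax (𝔄 := M_n(ℂ)) (𝔅 := M_n(ℂ)) wu wu′ (covD Λu η U₀u)` on the block's FINE bond set `Λu : Finset (Site P.d × Fin P.d)` with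
  the forward covariant-difference datum at a `U1`-valued background `U₀u` (flat `1` in the designed reading of the LOCALIZED
  u-tuple, kept general) and positive weights `wu wu′` with floors `w₀ w₀′` — the space in which (19) norms `A = (1∕iη) log U¹`;
  `η` = the slot's fine scale (the host's own `η`, bound before its first use); completeness = S109 f1 `instCompleteSpaceYsp`;
* THE LETTERS: `ℓs p := plaqReadOuts Λu η U₀u wu wu′ (plq p).1 (plq p).2.1 (plq p).2.2` for a placement
  `plq : ι → Site × Fin × Fin` of the classifier's plaquettes — [Balaban1985Variational] p. 283 (34)'s four η-SCALED letters of
  `∂p`, two of them `R(U₀)`-transported, up to the contour's base point (a cyclic rotation; immaterial here — sum and norms are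
  order-free; leaf-05-g11 F-2);
* LEAVING (DERIVED in S109 f1, census R12∕R13, W-i): `ℓs` (data, DEFINED), `κr` (:= `η∕w₀`), `hκ`,
  **`hℓ`** (`hℓ_plaqReadOuts_matrix`), `m` (:= `4`), **`hlen`**, `κc` (:= `2η²∕w₀′²`), `hκc`, **`hcurl`** (`hcurl_plaqReadOuts_matrix`
  — the Stokes identity + the `∇`-half of the max norm), and the (SM) rows `hs₁ ha hma` in their `κ`-form (`smRows_of_etaFree`);
* ENTERING: `Λu U₀u hU₀u wu wu′` + the two weight-positivity instances + floors `w₀ w₀′ hw₀ hw₀′ hfl hfl′` ([S]∕[N]∕[R] — the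
  (19) weights `Lʲη`-TYPE, a READING like R01's `m₀`), `plq` ([S]), and the (SM) rows in η-FREE form `hη1 : η ≤ 1`,
  `hs₁′ : 2X ≤ c₁·w₀′²·z`, `ha′ : X ≤ c₂·w₀·z`, `hma′ : 4X ≤ w₀` ([N];
  `X = ((ε₄ + B₀·2dLC₁ε₁) + B₀·4C2cov·(ε₄ + B₀·2dLC₁ε₁)²)` the host's Landau amplitude — ROW S95's LIFT RULE:
  `κr_j = η_j∕w₀`, `κc_j = 2η_j²∕w₀′²` are level profiles BY CONSTRUCTION, the numbers level-free);
* UNCHANGED: every other binder of link (3) — in particular the u-tuple's W-a rows `𝒢 W𝒱 h𝒢 hW H₁ hH₁ ιs hι Hop hH` and its real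
  structure `L 𝓡𝒵 𝓡ℬ h𝒢r hWr hιr hHr hH₁r hTr`, now TYPED ON THE DESIGNED CARRIER (sentence (i)); `hsm` keeps its shape with
  `m = 4`; `hudict` reads `holOf (plaqReadOuts …)` (node O's sentence, class O unchanged; its letters' side is one `rw` from the
  (1.22) word identity — leaf-05-g11 F-1, not here); the w-∕e-tuples, (T2)∕(T3)∕(S78), the γ3 readings, links (1)–(3)'s Schur ∕
  `hElb₁` ∕ coarse-geometry junctions — VERBATIM; conclusion `SlotAntiConcentration …` IDENTICAL (copied from the tree bytes).
CENSUS EFFECT (the owner's two engines decide, on THE ONE CALL's re-fire (5) over this END): expected T −5…−6 (R12's `hκ hℓ hlen`,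
R13's `hκc hcurl`), N∕S∕R + the entering rows.  NOT HERE: any discharge of (19)–(37) or of [5] Thms 3.12∕3.13; the w-tuple's
weight read-outs (R15a); the ONE CALL re-fire (leaf-09 lineage).  NOTHING in the countdown moves; NE7c NOT PROVED; spine PROVED 0∕9.
-/

noncomputable section

open Set Metric NormedSpace MeasureTheory Function

namespace Summit.QuantumFields.BalabanUV.T4Continuum.ShellMeasureLandauEndAssembledDecayCfLinCoTestsSchurCoarseReadOuts

open scoped ENNReal
open Literature.MathematicalPhysics.QuantumFieldTheory.Balaban1983to89
open B11Prop6Scheme (Prop4Hyp)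
open GaugeField (GaugeInvariant)
open T4ShellMeasure (SlotAntiConcentration)
open T4CubePoincare (cube)
open T4CubeChartGnomonic (SU2)
open T4CubeChartExp (expFibreChart)
open T4TreeGaugeFixing (fixTo)
open T4ShellMeasurePlaquette (expTail₂)
open ShellMeasureLevelAssembly (classifier)
open ShellMeasureMultiGridNorms (WSup)
open ShellMeasureMultiGridNorms.WSup (toPiL)
open ShellMeasurePinnedNorm (pinW pinDist pinDist_le_add)
open ShellMeasureLandauHolonomy (solAt landauExp)
open ShellMeasureLandauHolonomyChart (holOf cplx)
open ShellMeasureLandauHolonomySkew (readOutReal)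
open ShellMeasureDecayKernelSums (kerOp)
open T4AxialGaugeSmallField (boxPlaqs boxBonds)
open T4AxialGaugeFixing (combBonds)
open B7Prop2Explicit (C0 c2' unitaryUnits)
open B7Prop1Local (pdevOn loK bondHiK)
open B7Prop5Flat (BondIn)
open ShellMeasureAverageProp4General (O1cov C2cov)
open ShellMeasureLandauCorrectionB7 (landauCf landauRad)
open ShellMeasureLandauCorrectionReal (skewPi)
open ShellMeasureLandauCfBoxLocal (landauCfBox)
open ShellMeasureLandauEndAssembledDecayCfLinCoTestsSchurElb
  (slotAC_realized_su2_landauChart_assembled_decay_cfB7_lin_coTests_schur_elb)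
open ShellMeasureLiveEndLevelBlindRows (rowSum_coarse_le)
open TreeLengthTorus (TPt)
open B12Decay510Torus (pl1 pl1_nonneg)
open ShellMeasureLandauEndAssembledDecayCfLinCoTestsSchurCoarse
  (slotAC_realized_su2_landauChart_assembled_decay_cfB7_lin_coTests_schur_elb_coarse)
open ShellMeasureCommutatorCovDatum (covIdx covD)
open ShellMeasureLandauCfPinned (C2cov_nonneg)
open B7Prop1Explicit (U1)
open ShellMeasureReadOutsMax (Ysp plaqReadOuts hℓ_plaqReadOuts_matrix hlen_plaqReadOuts hcurl_plaqReadOuts_matrix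
  readOut_constants_nonneg smRows_of_etaFree)

section Box

open scoped Matrix.Norms.L2Operator

variable {P : Params} {j : ℕ} [DecidableEq (PBond P j)]
variable {n : Type*} [Fintype n] [DecidableEq n] [Nonempty n]
variable {𝒵 ℬ : Type*} [NormedAddCommGroup 𝒵] [NormedSpace ℂ 𝒵] [NormedAddCommGroup ℬ] [NormedSpace ℂ ℬ]
variable {𝔸 : Type*} [CStarAlgebra 𝔸] [Nontrivial 𝔸]


/-- **LINK (4): THE MOST-ASSEMBLED ONE-SLOT END OF THE CHAIN WITH THE u-TUPLE's CARRIER READ AS THE (19)∕(98) SOURCE SPACE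
AND ITS READ-OUT ROWS DERIVED** — link (3)
`slotAC_realized_su2_landauChart_assembled_decay_cfB7_lin_coTests_schur_elb_coarse`
BY NAME with `𝒴 := Ysp Λu η U₀u wu wu′`, `ℓs := plaqReadOuts …`, `κr := η∕w₀`, `m := 4`, `κc := 2η²∕w₀′²` (S109 f1), the (SM)
rows from the η-free `hs₁′ ha′ hma′`; every other binder and the
conclusion VERBATIM (module docstring: LEAVING∕ENTERING, the owner's sentences (i)(ii)).  CONDITIONAL on every displayed
binder; readings NOT asserted; NOT Bałaban's minimiser (node O); nothing of (19)–(37) discharged; NE7c NOT PROVED. [folklore] -/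
theorem slotAC_realized_su2_landauChart_assembled_decay_cfB7_lin_coTests_schur_elb_coarse_readOuts
    {lo hi : Fin P.d → ℤ} {nb : ℕ} (hn : ∀ κ, hi κ ≤ lo κ + nb) (hN : ∀ κ, hi κ - lo κ < P.sitesPerDir j)
    (Λ : Finset (PBond P j)) (hΛbox : ∀ b ∈ Λ, b ∈ boxBonds lo hi) (hΛcomb : Disjoint Λ (combBonds lo hi)) {m₀ : ℕ}
    (e : ↥Λ × Fin 3 ≃ Fin m₀) {S : ℝ} (hS : 0 < S) (hSπ : 3 * S ^ 2 < Real.pi ^ 2) {F : GaugeField P j SU2 → ℝ≥0∞}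
    (hF : Measurable F) (hFi : GaugeInvariant F) {u : GaugeField P j SU2 → ℝ} (hu : Measurable u) (hui : GaugeInvariant u)
    {ι : Type*} {Pu : Finset ι} (hPu : Pu.Nonempty)
    -- the classifier's plaquettes PLACED on the fine lattice: `plq p = (x, μ, ν)` ⇒ `ℓs p :=` the four (Ad-twisted) lattice-angle
    -- read-outs of `∂p` (S109 f1 `plaqReadOuts`; [Balaban1985Variational] (34)'s letters) — R12∕R13 `hκ hℓ hlen hκc hcurl` DERIVED
    (plq : ι → B7Prop1Explicit.Site P.d × Fin P.d × Fin P.d) {κN : Type*} (N : Finset κN) {ιN : κN → Type*}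
    {PuN : (i : κN) → Finset (ιN i)} (hPuN : ∀ i, (PuN i).Nonempty) {AN : Type*} [NormedRing AN] [NormedAlgebra ℂ AN]
    [CompleteSpace AN] (holN : (i : κN) → GaugeField P j SU2 → ιN i → (Fin m₀ → ℝ) → AN) {θN RN HN δN : κN → ℝ}
    (hRN : ∀ i ∈ N, 1 < RN i) (hθN : ∀ i ∈ N, 0 < θN i) (hδ0N : ∀ i ∈ N, 0 ≤ δN i) (hδ1N : ∀ i ∈ N, δN i ≤ 1)
    (hSMN : ∀ i ∈ N, 36 * HN i * 1 ^ 2 / (RN i - 1) ^ 2 ≤ δN i * θN i)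
    (hANN : ∀ i ∈ N, ∀ V, ∀ x ∈ closedBall (0 : Fin m₀ → ℝ) S, ∀ p ∈ PuN i, ∃ f : ℂ → AN, DifferentiableOn ℂ f (ball 0 (RN i)) ∧
      (∀ w ∈ ball (0 : ℂ) (RN i), ‖f w‖ ≤ HN i) ∧ f 0 = 0 ∧ ∀ c : ℝ, 0 ≤ c → c ≤ 1 → f (c : ℂ) = holN i V p (c • x) - 1)
    {δ ρ β : ℝ}
    -- ══ ROW S109 (R-ne7cp1-g36-12 (4)): the u-tuple's carrier READ as the (19)∕(98) source space on the block's
    -- fine bond set `Λu` with the `∇^η_{U₀u}`-datum (S65 f2c∕f5b, S109 f1 `Ysp`), weights `wu wu′` with floors; `η` = the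
    -- slot's fine scale (bound here, before its first use; the host binds it with `εθ c₁ c₂ z`) ══
    {η : ℝ} (Λu : Finset (B7Prop1Explicit.Site P.d × Fin P.d))
    (U₀u : B7Prop1Explicit.Site P.d → Fin P.d → (Matrix n n ℂ)ˣ) (hU₀u : ∀ y κ, U₀u y κ ∈ U1 (Matrix n n ℂ))
    (wu : ↥Λu → ℝ) (wu' : ↥(covIdx Λu) → ℝ) [Fact (∀ b, 0 < wu b)] [Fact (∀ i, 0 < wu' i)]
    {w₀ w₀' : ℝ} (hw₀ : 0 < w₀) (hw₀' : 0 < w₀') (hfl : ∀ b, w₀ ≤ wu b) (hfl' : ∀ i, w₀' ≤ wu' i)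
    (𝒢 : GaugeField P j SU2 → (𝒵 →L[ℂ] (Ysp Λu η U₀u wu wu'))) (W𝒱 : GaugeField P j SU2 → (Ysp Λu η U₀u wu wu') → 𝒵)
    {B₀ C₄ a₃ ε₄ : ℝ} (h𝒢 : ∀ V f, ‖𝒢 V f‖ ≤ B₀ * ‖f‖) (hW : ∀ V, Prop4Hyp (W𝒱 V) C₄ a₃) (hB₀ : 0 < B₀) (hC₄ : 0 ≤ C₄)
    (hε₄ : 0 ≤ ε₄) {dL C₁ B₃ ε₁ : ℝ} (hdL : 0 ≤ dL) (hC₁ : 0 ≤ C₁) (hε₁ : 0 ≤ ε₁) (hB₃ : dL ≤ B₃)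
    (h1 : 2 * B₀ * C₁ * B₃ * ε₁ ≤ ε₄) (h2 : 4 * ε₄ ≤ a₃) (h3 : 16 * B₀ * C₄ * ε₄ ≤ 1)
    (H₁ : GaugeField P j SU2 → (ℬ →L[ℂ] (Ysp Λu η U₀u wu wu'))) (hH₁ : ∀ V B, ‖H₁ V B‖ ≤ B₀ * ‖B‖)
    (T : GaugeField P j SU2 → ((Fin m₀ → ℂ) →L[ℂ] ℬ)) {rΦ : ℝ} (hTb : ∀ V, ‖T V‖ * rΦ < 2 * dL * C₁ * ε₁) (hSr : S < rΦ) (k : ℕ)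
    (Sf Sf' Sw Sw' Se Se' : Finset (B7Prop1Explicit.Site P.d × Fin P.d))
    (Ubg : GaugeField P j SU2 → B7Prop1Explicit.Site P.d → Fin P.d → 𝔸ˣ) (hUbg : ∀ V x κ, Ubg V x κ ∈ unitaryUnits 𝔸) {α₀ : ℝ}
    (hα : 0 < α₀) (hα3 : C0 P.d * α₀ ≤ 1 / 3) (hα4 : 4 * α₀ ≤ c2' P.d P.L) (hα6 : 4 * O1cov P.d * α₀ ≤ 1 / 3)
    (h52locw : ∀ V (c : ↥Sw'), pdevOn (loK P.L k c.1.1) (bondHiK P.L k c.1.1 c.1.2) (Ubg V) < α₀ * (((P.L : ℝ) ^ k)⁻¹) ^ 2)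
    (h52loce : ∀ V (c : ↥Se'), pdevOn (loK P.L k c.1.1) (bondHiK P.L k c.1.1 c.1.2) (Ubg V) < α₀ * (((P.L : ℝ) ^ k)⁻¹) ^ 2)
    (ϖe₁ : ↥Se → ℝ) (ϖe₂ : ↥Se' → ℝ) (hϖe₁ : ∀ b, 0 ≤ ϖe₁ b) (hϖe₂ : ∀ c, 0 ≤ ϖe₂ c) {r₀e : ℝ}
    (hreache : ∀ (c : ↥Se') (s : ↥Se), BondIn (loK P.L k c.1.1) (bondHiK P.L k c.1.1 c.1.2) s.1.1 s.1.2 → ϖe₂ c - r₀e ≤ ϖe₁ s)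
    (ιs : GaugeField P j SU2 → ((Ysp Λu η U₀u wu wu') →L[ℂ] (↥Sf → 𝔸))) (hι : ∀ V Y, ‖ιs V Y‖ ≤ ‖Y‖)
    (Hop : GaugeField P j SU2 → ((↥Sf' → 𝔸) →L[ℂ] (Ysp Λu η U₀u wu wu'))) (hH : ∀ V X, ‖Hop V X‖ ≤ B₀ * ‖X‖) {ε₃ : ℝ}
    (h18 : 18 * C2cov P.d * B₀ * ε₃ ≤ 1) (hcoup : ε₄ + B₀ * (2 * dL * C₁ * ε₁) ≤ ε₃) (h3R : 3 * ε₃ ≤ landauRad P.d P.L)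
    {Λw Λz Λb : Type*} [Fintype Λw] [DecidableEq Λw] [Fintype Λz] [Fintype Λb] {𝔄w ℭ 𝔇 : Type*} [NormedAddCommGroup 𝔄w]
    [NormedSpace ℂ 𝔄w] [CompleteSpace 𝔄w] [NormedAddCommGroup ℭ] [NormedSpace ℂ ℭ] [NormedAddCommGroup 𝔇] [NormedSpace ℂ 𝔇]
    {δw : ℝ} (hδw : 0 ≤ δw) {Nc : ℕ} [NeZero Nc] (Bref : Finset (TPt P.d Nc)) (hBref : Bref.Nonempty) (pos : Λw → TPt P.d Nc)
    (posz : Λz → TPt P.d Nc) (pos' : ↥Sw → TPt P.d Nc) (posx : ↥Sw' → TPt P.d Nc) (posb : Λb → TPt P.d Nc)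
    {multw multz multx multb : ℕ} (hmultw : ∀ x, (Finset.univ.filter fun b' => pos b' = x).card ≤ multw)
    (hmultz : ∀ x, (Finset.univ.filter fun b' => posz b' = x).card ≤ multz)
    (hmultx : ∀ x, (Finset.univ.filter fun b' => posx b' = x).card ≤ multx)
    (hmultb : ∀ x, (Finset.univ.filter fun b' => posb b' = x).card ≤ multb) (k𝒢 : GaugeField P j SU2 → Λw → Λz → (ℭ →L[ℂ] 𝔄w))
    (kι : GaugeField P j SU2 → ↥Sw → Λw → (𝔄w →L[ℂ] 𝔸)) (kH : GaugeField P j SU2 → Λw → ↥Sw' → (𝔸 →L[ℂ] 𝔄w))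
    (kH₁ : GaugeField P j SU2 → Λw → Λb → (𝔇 →L[ℂ] 𝔄w)) {c𝒢 δ𝒢 M𝒢 cι δι Mι cH δH MH cH₁ δH₁ MH₁ : ℝ} (hc𝒢 : 0 ≤ c𝒢)
    (hk𝒢 : ∀ V c b', ‖k𝒢 V c b'‖ ≤ c𝒢 * Real.exp (-(δ𝒢 * pl1 (pos c - posz b')))) (hgap𝒢 : δw < δ𝒢)
    (hM𝒢c : (multz : ℝ) * (2 * ((P.d : ℝ) + (δ𝒢 - δw)) / (δ𝒢 - δw)) ^ P.d ≤ M𝒢) (hcι : 0 ≤ cι)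
    (hkι : ∀ V c b', ‖kι V c b'‖ ≤ cι * Real.exp (-(δι * pl1 (pos' c - pos b')))) (hgapι : δw < δι)
    (hMιc : (multw : ℝ) * (2 * ((P.d : ℝ) + (δι - δw)) / (δι - δw)) ^ P.d ≤ Mι) (hcH : 0 ≤ cH)
    (hkH : ∀ V c b', ‖kH V c b'‖ ≤ cH * Real.exp (-(δH * pl1 (pos c - posx b')))) (hgapH : δw < δH)
    (hMHc : (multx : ℝ) * (2 * ((P.d : ℝ) + (δH - δw)) / (δH - δw)) ^ P.d ≤ MH) (hcH₁ : 0 ≤ cH₁)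
    (hkH₁ : ∀ V c b', ‖kH₁ V c b'‖ ≤ cH₁ * Real.exp (-(δH₁ * pl1 (pos c - posb b')))) (hgapH₁ : δw < δH₁)
    (hMH₁c : (multb : ℝ) * (2 * ((P.d : ℝ) + (δH₁ - δw)) / (δH₁ - δw)) ^ P.d ≤ MH₁)
    (W𝒱w : GaugeField P j SU2 → (Λw → 𝔄w) → (Λz → ℭ)) {B₀w C₄w a₃w ε₄w bw : ℝ} (hB𝒢w : c𝒢 * M𝒢 ≤ B₀w)
    (hWw : ∀ V, Prop4Hyp (W𝒱w V) C₄w a₃w) (hB₀w : 0 < B₀w) (hC₄w : 0 ≤ C₄w) (hε₄w : 0 ≤ ε₄w)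
    (hdomw : 2 * (ε₄w + B₀w * bw) ≤ a₃w) (hselfw : B₀w * C₄w * (ε₄w + B₀w * bw) ^ 2 ≤ ε₄w)
    (hcontrw : 4 * B₀w * C₄w * (ε₄w + B₀w * bw) < 1) (hBH₁w : cH₁ * MH₁ ≤ B₀w)
    (Tw : GaugeField P j SU2 → ((Fin m₀ → ℂ) →L[ℂ] (Λb → 𝔇))) {rΦw : ℝ} (hTbw : ∀ V, ‖Tw V‖ * rΦw < bw) (h2Sw : 2 * S ≤ rΦw)
    (hιw : ∀ V Y, ‖kerOp (kι V) Y‖ ≤ ‖Y‖) (hBHw : cH * MH ≤ B₀w) (hqw : 9 * C2cov P.d * B₀w * (ε₄w + B₀w * bw) < 1)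
    (hRCw : 6 * (ε₄w + B₀w * bw) ≤ landauRad P.d P.L) (NW : Λz → Λw → Prop)
    (hlocW : ∀ V, ∀ A A' : Λw → 𝔄w, ∀ c', (∀ b', NW c' b' → A b' = A' b') → W𝒱w V A c' = W𝒱w V A' c') {rW : ℝ}
    (hreachW : ∀ c' b', NW c' b' → pinDist Bref hBref (posz c') - rW ≤ pinDist Bref hBref (pos b')) {rC : ℝ}
    (hreachC : ∀ (c' : ↥Sw') (b' : ↥Sw), BondIn (loK P.L k c'.1.1) (bondHiK P.L k c'.1.1 c'.1.2) b'.1.1 b'.1.2 → pinDist Bref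
      hBref (posx c') - rC ≤ pinDist Bref hBref (pos' b'))
    (hsupp : ∀ V, ∀ z : Fin m₀ → ℂ, ∀ i, 0 < pinDist Bref hBref (posb i) → Tw V z i = 0)
    (hqW : c𝒢 * M𝒢 * (2 * C₄w * a₃w * Real.exp (δw * rW)) < 1)
    (hk : 2 * C2cov P.d * landauRad P.d P.L * Real.exp (δw * rC) * (cι * Mι) * (cH * MH) < 1) {𝔭 : Type*} (Pw : Finset 𝔭)
    (ℓw : 𝔭 → List ((Λw → 𝔄w) →L[ℂ] Matrix n n ℂ)) (suppw : 𝔭 → Finset Λw) (ϖPw : 𝔭 → ℝ)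
    (hblindw : ∀ p ∈ Pw, ∀ ℓ ∈ ℓw p, ∀ A A' : Λw → 𝔄w, (∀ b' ∈ suppw p, A b' = A' b') → ℓ A = ℓ A')
    (hdepthw : ∀ p ∈ Pw, ∀ b' ∈ suppw p, ϖPw p ≤ pinDist Bref hBref (pos b')) (hϖPw : ∀ p ∈ Pw, 0 ≤ ϖPw p) {κwb κcb : ℝ}
    (hκwb : 0 ≤ κwb) (hκcb : 0 ≤ κcb) (hℓwb : ∀ p ∈ Pw, ∀ ℓ ∈ ℓw p, ‖ℓ‖ ≤ κwb) (hcurlw : ∀ p ∈ Pw, ‖(ℓw p).sum‖ ≤ κcb) {mw : ℕ}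
    (hlenw : ∀ p ∈ Pw, (ℓw p).length ≤ mw) (𝓡𝒴w : AddSubgroup (Λw → 𝔄w)) (h𝓡𝒴w : IsClosed (𝓡𝒴w : Set (Λw → 𝔄w)))
    (𝓡𝒵w : AddSubgroup (Λz → ℭ)) (𝓡ℬw : AddSubgroup (Λb → 𝔇)) (h𝒢rw : ∀ V, ∀ f ∈ 𝓡𝒵w, kerOp (k𝒢 V) f ∈ 𝓡𝒴w)
    (hWrw : ∀ V, ∀ Y ∈ 𝓡𝒴w, W𝒱w V Y ∈ 𝓡𝒵w) (hιrw : ∀ V, ∀ Y ∈ 𝓡𝒴w, kerOp (kι V) Y ∈ skewPi ↥Sw)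
    (hHrw : ∀ V, ∀ X ∈ skewPi (𝔸 := 𝔸) ↥Sw', kerOp (kH V) X ∈ 𝓡𝒴w) (hH₁rw : ∀ V, ∀ B ∈ 𝓡ℬw, kerOp (kH₁ V) B ∈ 𝓡𝒴w)
    (hTrw : ∀ V (y : Fin m₀ → ℝ), Tw V (cplx y) ∈ 𝓡ℬw)
    (hskew : ∀ p ∈ Pw, ∀ ℓ ∈ ℓw p, ∀ Y ∈ 𝓡𝒴w, ℓ Y ∈ skewAdjoint (Matrix n n ℂ)) (Bp : GaugeField P j SU2 → 𝔭 → Matrix n n ℂ)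
    {d : 𝔭 → ℝ} {dbar : ℝ} (hBu : ∀ V, ∀ p ∈ Pw, Bp V p ∈ unitary (Matrix n n ℂ)) (hBd : ∀ V, ∀ p ∈ Pw, ‖Bp V p - 1‖ ≤ d p)
    (hd : ∀ p ∈ Pw, d p ≤ dbar) (hdbar : 0 ≤ dbar) {Kw : ℝ} (hKw : ∑ p ∈ Pw, Real.exp (-(δw * ϖPw p)) ≤ Kw) {Λe : Type*}
    [Fintype Λe] {𝔄 : Type*} [NormedAddCommGroup 𝔄] [NormedSpace ℂ 𝔄] [CompleteSpace 𝔄] {δ' : ℝ} {ϖ : Λe → ℝ} (hδ' : 0 ≤ δ')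
    (hϖ : ∀ b', 0 ≤ ϖ b') {𝒵e ℬe : Type*} [NormedAddCommGroup 𝒵e] [NormedSpace ℂ 𝒵e] [NormedAddCommGroup ℬe] [NormedSpace ℂ ℬe]
    (𝒢e : GaugeField P j SU2 → (𝒵e →L[ℂ] WSup (pinW δ' ϖ) 1 𝔄)) (W𝒱e : GaugeField P j SU2 → WSup (pinW δ' ϖ) 1 𝔄 → 𝒵e)
    {B₀e C₄e a₃e be ε₄e : ℝ} (h𝒢e : ∀ V f, ‖𝒢e V f‖ ≤ B₀e * ‖f‖) (hWe : ∀ V, Prop4Hyp (W𝒱e V) C₄e a₃e) (hB₀e : 0 < B₀e)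
    (hC₄e : 0 ≤ C₄e) (hbe : 0 ≤ be) (hε₄e : 0 ≤ ε₄e) (hdome : 2 * (ε₄e + B₀e * be) ≤ a₃e)
    (hselfe : B₀e * C₄e * (ε₄e + B₀e * be) ^ 2 ≤ ε₄e) (hcontre : 4 * B₀e * C₄e * (ε₄e + B₀e * be) < 1)
    (H₁e : GaugeField P j SU2 → (ℬe →L[ℂ] WSup (pinW δ' ϖ) 1 𝔄)) (hH₁e : ∀ V B, ‖H₁e V B‖ ≤ B₀e * ‖B‖)
    (Te : GaugeField P j SU2 → ((Fin m₀ → ℂ) →L[ℂ] ℬe)) {rΦe : ℝ} (hTbe : ∀ V, ‖Te V‖ * rΦe < be) (hSre : S < rΦe)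
    (ιe : GaugeField P j SU2 → (WSup (pinW δ' ϖ) 1 𝔄 →L[ℂ] WSup (pinW δ' ϖe₁) 1 𝔸)) (hιe : ∀ V Y, ‖ιe V Y‖ ≤ ‖Y‖)
    (He : GaugeField P j SU2 → (WSup (pinW δ' ϖe₂) 1 𝔸 →L[ℂ] WSup (pinW δ' ϖ) 1 𝔄)) (hHe : ∀ V X, ‖He V X‖ ≤ B₀e * ‖X‖)
    (hqe : 9 * (C2cov P.d * Real.exp (2 * δ' * r₀e)) * B₀e * (ε₄e + B₀e * be) < 1)
    (hRCe : 3 * (ε₄e + B₀e * be) ≤ landauRad P.d P.L) {𝔱 : Type*} (I : Finset 𝔱) {Ef : 𝔱 → (Λe → 𝔄) → ℂ} {rE : ℝ} {ee : 𝔱 → ℝ}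
    (hrE : 0 < rE) (hEd : ∀ i ∈ I, DifferentiableOn ℂ (Ef i) (ball 0 rE))
    (hEb : ∀ i ∈ I, ∀ Z ∈ ball (0 : Λe → 𝔄) rE, ‖Ef i Z‖ ≤ ee i) (supp : 𝔱 → Finset Λe)
    (hblind : ∀ i ∈ I, ∀ A₁ A₂ : Λe → 𝔄, (∀ b' ∈ supp i, A₁ b' = A₂ b') → Ef i A₁ = Ef i A₂) (ϖP : 𝔱 → ℝ)
    (hdepth : ∀ i ∈ I, ∀ b' ∈ supp i, ϖP i ≤ ϖ b') {LK : ℝ} (hK : ∑ i ∈ I, 2 * ee i / rE * Real.exp (-(δ' * ϖP i)) ≤ LK)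
    (hcoupE : ((ε₄e + B₀e * be) + B₀e * (4 * (C2cov P.d * Real.exp (2 * δ' * r₀e)) * (ε₄e + B₀e * be) ^ 2)) ≤ rE / 2)
    {Ω : Type*} [MeasurableSpace Ω] (μ : Measure Ω) {g : Ω → ℝ} (hg : ∀ ω, 0 ≤ g ω)
    (A : GaugeField P j SU2 → (Fin m₀ → ℝ) → Ω → ℝ) {Bd : ℝ}
    (hint : ∀ V, ∀ x ∈ closedBall (0 : Fin m₀ → ℝ) S, ∀ c : ℝ, 1 / 2 ≤ c → c ≤ 1 → Integrable (fun ω => g ω * Real.exp (A V (c •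
      x) ω)) μ)
    (hpos : ∀ V, ∀ x ∈ closedBall (0 : Fin m₀ → ℝ) S, ∀ c : ℝ, 1 / 2 ≤ c → c ≤ 1 → 0 < ∫ ω, g ω * Real.exp (A V (c • x) ω) ∂μ)
    (hA : ∀ V, ∀ x ∈ closedBall (0 : Fin m₀ → ℝ) S, ∀ c : ℝ, 1 / 2 ≤ c → c ≤ 1 → ∀ ω, A V x ω ≤ A V (c • x) ω + (1 - c) * Bd)
    {BE₂ : ℝ} (hElb₂ : ∀ V (y : Fin m₀ → ℝ), ‖y‖ ≤ S → -BE₂ ≤ (-Real.log (∫ ω, g ω * Real.exp (A V y ω) ∂μ)))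
    (L : Set ((Ysp Λu η U₀u wu wu') →L[ℂ] Matrix n n ℂ)) (𝓡𝒵 : AddSubgroup 𝒵) (𝓡ℬ : AddSubgroup ℬ)
    (h𝒢r : ∀ V, ∀ f ∈ 𝓡𝒵, 𝒢 V f ∈ readOutReal L) (hWr : ∀ V, ∀ Y ∈ readOutReal L, W𝒱 V Y ∈ 𝓡𝒵)
    (hιr : ∀ V, ∀ Y ∈ readOutReal L, ιs V Y ∈ skewPi ↥Sf) (hHr : ∀ V, ∀ X ∈ skewPi (𝔸 := 𝔸) ↥Sf', Hop V X ∈ readOutReal L)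
    (hH₁r : ∀ V, ∀ B ∈ 𝓡ℬ, H₁ V B ∈ readOutReal L) (hTr : ∀ V (y : Fin m₀ → ℝ), T V (cplx y) ∈ 𝓡ℬ)
    (hRdict : ∀ V, ∀ x ∈ cube m₀ S, F (fixTo (combBonds lo hi) 1 (updateFinset V Λ (expFibreChart Λ 1 e x))) = (closedBall (0 :
      Fin m₀ → ℝ) S ∩ ⋂ i ∈ N, {y | classifier (hPuN i) (holN i V) y < θN i}).indicator (1 : (Fin m₀ → ℝ) → ℝ≥0∞) x *
      ENNReal.ofReal (Real.exp (-((∑ p ∈ Pw, β * (1 - (Matrix.trace (Bp V p * holOf (ℓw p) (fun y => landauExp (landauCfBox P.L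
      (Ubg V) k Sw Sw' (landauRad P.d P.L)) (kerOp (kι V)) (kerOp (kH V)) (4 * C2cov P.d * (ε₄w + B₀w * bw) ^ 2) (solAt (kerOp
      (k𝒢 V)) 0 (W𝒱w V) ε₄w (0 : Λz → ℭ) (kerOp (kH₁ V) (Tw V (cplx y))) + kerOp (kH₁ V) (Tw V (cplx y)))) x)).re / Fintype.card
      n)) + ((∑ i ∈ I, Ef i (WSup.toPiL (𝔄 := 𝔄) (pinW δ' ϖ) 1 (landauExp (fun Y : WSup (pinW δ' ϖe₁) 1 𝔸 => ((toPiL (pinW δ'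
      ϖe₂) 1).symm (landauCf P.L (Ubg V) k Se Se' (toPiL (pinW δ' ϖe₁) 1 Y)) : WSup (pinW δ' ϖe₂) 1 𝔸)) (ιe V) (He V) (4 *
      (C2cov P.d * Real.exp (2 * δ' * r₀e)) * (ε₄e + B₀e * be) ^ 2) (solAt (𝒢e V) 0 (W𝒱e V) ε₄e (0 : 𝒵e) (H₁e V (Te V (cplx x)))
      + H₁e V (Te V (cplx x)))))).re + (-Real.log (∫ ω, g ω * Real.exp (A V x ω) ∂μ)))))))
    (hudict : ∀ V, ∀ x ∈ cube m₀ S, u (fixTo (combBonds lo hi) 1 (updateFinset V Λ (expFibreChart Λ 1 e x))) = classifier hPu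
      (fun p => holOf (plaqReadOuts Λu η U₀u wu wu' (plq p).1 (plq p).2.1 (plq p).2.2) (fun y => landauExp ((ball (0 : ↥Sf → 𝔸)
      (landauRad P.d P.L)).indicator (landauCf P.L (1 : B7Prop1Explicit.Site P.d → Fin P.d → 𝔸ˣ) k Sf Sf')) (ιs V) (Hop V) (4 *
      C2cov P.d * (ε₄ + B₀ * (2 * dL * C₁ * ε₁)) ^ 2) (solAt (𝒢 V) 0 (W𝒱 V) ε₄ (0 : 𝒵) (H₁ V (T V (cplx y))) + H₁ V (T V (cplx
      y))))) x)
    (hδ0 : 0 ≤ δ) (hδ1 : δ < 1) (hρ0 : 0 ≤ ρ) (hρ : ρ ≤ (1 - δ) / 2) (hβ : 0 ≤ β) {εθ c₁ c₂ z : ℝ} (hη : 0 < η) (hεθ : 0 < εθ)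
    -- (SM) IN η-FREE NUMBERS (S109 f1 `smRows_of_etaFree`; ROW S95's LIFT RULE): with `κr := η∕w₀`, `κc := 2η²∕w₀′²`, `m := 4`
    -- the host's `hs₁ ha hma` follow at every `0 < η ≤ 1` from these level-free inequalities on the Landau amplitude
    (hη1 : η ≤ 1) (hs₁' : 2 * ((ε₄ + B₀ * (2 * dL * C₁ * ε₁)) + B₀ * (4 * C2cov P.d * (ε₄ + B₀ * (2 * dL * C₁ * ε₁)) ^ 2)) ≤ c₁
      * w₀' ^ 2 * z)
    (ha' : ((ε₄ + B₀ * (2 * dL * C₁ * ε₁)) + B₀ * (4 * C2cov P.d * (ε₄ + B₀ * (2 * dL * C₁ * ε₁)) ^ 2)) ≤ c₂ * w₀ * z) (hma' : 4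
      * ((ε₄ + B₀ * (2 * dL * C₁ * ε₁)) + B₀ * (4 * C2cov P.d * (ε₄ + B₀ * (2 * dL * C₁ * ε₁)) ^ 2)) ≤ w₀)
    (hsm : 36 * (c₁ * z + (4 : ℕ) ^ 2 * c₂ ^ 2 * z ^ 2) / (rΦ / S - 1) ^ 2 ≤ δ * εθ) {a : ℝ} (ha0 : 0 ≤ a)
    (hrad : ((P.d - 1 : ℕ) : ℝ) * nb * a ≤ 2 * Real.sin (S / 2)) {Pcore Pcollar : Set (Plaq P j)}
    (hcover : boxPlaqs lo hi ⊆ Pcore ∪ Pcollar)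
    (hcore : ∀ (V : GaugeField P j SU2) (y : ↥Λ → SU2), u (fixTo (combBonds lo hi) 1 (updateFinset V Λ y)) < εθ * η ^ 2 →
      PlaqSmallOn Pcore a (fixTo (combBonds lo hi) 1 (updateFinset V Λ y)))
    (hcollar : ∀ (V : GaugeField P j SU2) (y : ↥Λ → SU2), F (fixTo (combBonds lo hi) 1 (updateFinset V Λ y)) ≠ 0 → PlaqSmallOn
      Pcollar a (fixTo (combBonds lo hi) 1 (updateFinset V Λ y))) :
    SlotAntiConcentration ((fieldMeasure P j SU2).withDensity F) u (εθ * η ^ 2) ρ (2 * ((m₀ : ℝ) + (3 * (|β| * ((dbar + 2 * (κcb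
      * (cH₁ * MH₁ * bw / ((1 - c𝒢 * M𝒢 * (2 * C₄w * a₃w * Real.exp (δw * rW))) * (1 - 2 * C2cov P.d * landauRad P.d P.L *
      Real.exp (δw * rC) * (cι * Mι) * (cH * MH)))) + expTail₂ (mw * (κwb * (cH₁ * MH₁ * bw / ((1 - c𝒢 * M𝒢 * (2 * C₄w * a₃w *
      Real.exp (δw * rW))) * (1 - 2 * C2cov P.d * landauRad P.d P.L * Real.exp (δw * rC) * (cι * Mι) * (cH * MH))))))) / (rΦw /
      S)) * (2 * (κcb * (cH₁ * MH₁ * bw / ((1 - c𝒢 * M𝒢 * (2 * C₄w * a₃w * Real.exp (δw * rW))) * (1 - 2 * C2cov P.d * landauRad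
      P.d P.L * Real.exp (δw * rC) * (cι * Mι) * (cH * MH)))) + expTail₂ (mw * (κwb * (cH₁ * MH₁ * bw / ((1 - c𝒢 * M𝒢 * (2 * C₄w
      * a₃w * Real.exp (δw * rW))) * (1 - 2 * C2cov P.d * landauRad P.d P.L * Real.exp (δw * rC) * (cι * Mι) * (cH * MH))))))) /
      (rΦw / S))) * Kw) + (3 * (LK * (2 * ((ε₄e + B₀e * be) + B₀e * (4 * (C2cov P.d * Real.exp (2 * δ' * r₀e)) * (ε₄e + B₀e *
      be) ^ 2)))) / (rΦe / S - 1) + Bd))) / (1 - δ)) := by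
  have hC2 : 0 ≤ C2cov P.d := C2cov_nonneg P.d
  have hX : 0 ≤ ((ε₄ + B₀ * (2 * dL * C₁ * ε₁)) + B₀ * (4 * C2cov P.d * (ε₄ + B₀ * (2 * dL * C₁ * ε₁)) ^ 2)) := by positivity
  have hSM := smRows_of_etaFree (c₁ := c₁) (c₂ := c₂) (zs := z) hη hη1 hw₀ hw₀' hX hs₁' ha' hma'
  exact slotAC_realized_su2_landauChart_assembled_decay_cfB7_lin_coTests_schur_elb_coarse
      (lo := lo) (hi := hi) (nb := nb) (hn := hn) (hN := hN) (Λ := Λ) (hΛbox := hΛbox) (hΛcomb := hΛcomb) (m₀ := m₀) (e := e)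
      (S := S) (hS := hS) (hSπ := hSπ) (F := F) (hF := hF) (hFi := hFi) (u := u) (hu := hu) (hui := hui) (ι := ι) (Pu := Pu)
      (hPu := hPu) (κN := κN) (N := N) (ιN := ιN) (PuN := PuN) (hPuN := hPuN) (AN := AN) (holN := holN) (θN := θN) (RN := RN)
      (HN := HN) (δN := δN) (hRN := hRN) (hθN := hθN) (hδ0N := hδ0N) (hδ1N := hδ1N) (hSMN := hSMN) (hANN := hANN) (δ := δ)
      (ρ := ρ) (β := β) (𝒢 := 𝒢) (W𝒱 := W𝒱) (B₀ := B₀) (C₄ := C₄) (a₃ := a₃) (ε₄ := ε₄) (h𝒢 := h𝒢) (hW := hW) (hB₀ := hB₀)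
      (hC₄ := hC₄) (hε₄ := hε₄) (dL := dL) (C₁ := C₁) (B₃ := B₃) (ε₁ := ε₁) (hdL := hdL) (hC₁ := hC₁) (hε₁ := hε₁) (hB₃ := hB₃)
      (h1 := h1) (h2 := h2) (h3 := h3) (H₁ := H₁) (hH₁ := hH₁) (T := T) (rΦ := rΦ) (hTb := hTb) (hSr := hSr) (k := k) (Sf := Sf)
      (Sf' := Sf') (Sw := Sw) (Sw' := Sw') (Se := Se) (Se' := Se') (Ubg := Ubg) (hUbg := hUbg) (α₀ := α₀) (hα := hα)
      (hα3 := hα3) (hα4 := hα4) (hα6 := hα6) (h52locw := h52locw) (h52loce := h52loce) (ϖe₁ := ϖe₁) (ϖe₂ := ϖe₂) (hϖe₁ := hϖe₁)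
      (hϖe₂ := hϖe₂) (r₀e := r₀e) (hreache := hreache) (ιs := ιs) (hι := hι) (Hop := Hop) (hH := hH) (ε₃ := ε₃) (h18 := h18)
      (hcoup := hcoup) (h3R := h3R) (Λw := Λw) (Λz := Λz) (Λb := Λb) (𝔄w := 𝔄w) (ℭ := ℭ) (𝔇 := 𝔇) (δw := δw) (hδw := hδw)
      (Nc := Nc) (Bref := Bref) (hBref := hBref) (pos := pos) (posz := posz) (pos' := pos') (posx := posx) (posb := posb)
      (multw := multw) (multz := multz) (multx := multx) (multb := multb) (hmultw := hmultw) (hmultz := hmultz)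
      (hmultx := hmultx) (hmultb := hmultb) (k𝒢 := k𝒢) (kι := kι) (kH := kH) (kH₁ := kH₁) (c𝒢 := c𝒢) (δ𝒢 := δ𝒢) (M𝒢 := M𝒢)
      (cι := cι) (δι := δι) (Mι := Mι) (cH := cH) (δH := δH) (MH := MH) (cH₁ := cH₁) (δH₁ := δH₁) (MH₁ := MH₁) (hc𝒢 := hc𝒢)
      (hk𝒢 := hk𝒢) (hgap𝒢 := hgap𝒢) (hM𝒢c := hM𝒢c) (hcι := hcι) (hkι := hkι) (hgapι := hgapι) (hMιc := hMιc) (hcH := hcH)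
      (hkH := hkH) (hgapH := hgapH) (hMHc := hMHc) (hcH₁ := hcH₁) (hkH₁ := hkH₁) (hgapH₁ := hgapH₁) (hMH₁c := hMH₁c)
      (W𝒱w := W𝒱w) (B₀w := B₀w) (C₄w := C₄w) (a₃w := a₃w) (ε₄w := ε₄w) (bw := bw) (hB𝒢w := hB𝒢w) (hWw := hWw) (hB₀w := hB₀w)
      (hC₄w := hC₄w) (hε₄w := hε₄w) (hdomw := hdomw) (hselfw := hselfw) (hcontrw := hcontrw) (hBH₁w := hBH₁w) (Tw := Tw)
      (rΦw := rΦw) (hTbw := hTbw) (h2Sw := h2Sw) (hιw := hιw) (hBHw := hBHw) (hqw := hqw) (hRCw := hRCw) (NW := NW)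
      (hlocW := hlocW) (rW := rW) (hreachW := hreachW) (rC := rC) (hreachC := hreachC) (hsupp := hsupp) (hqW := hqW) (hk := hk)
      (𝔭 := 𝔭) (Pw := Pw) (ℓw := ℓw) (suppw := suppw) (ϖPw := ϖPw) (hblindw := hblindw) (hdepthw := hdepthw) (hϖPw := hϖPw)
      (κwb := κwb) (κcb := κcb) (hκwb := hκwb) (hκcb := hκcb) (hℓwb := hℓwb) (hcurlw := hcurlw) (mw := mw) (hlenw := hlenw)
      (𝓡𝒴w := 𝓡𝒴w) (h𝓡𝒴w := h𝓡𝒴w) (𝓡𝒵w := 𝓡𝒵w) (𝓡ℬw := 𝓡ℬw) (h𝒢rw := h𝒢rw) (hWrw := hWrw) (hιrw := hιrw) (hHrw := hHrw)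
      (hH₁rw := hH₁rw) (hTrw := hTrw) (hskew := hskew) (Bp := Bp) (d := d) (dbar := dbar) (hBu := hBu) (hBd := hBd) (hd := hd)
      (hdbar := hdbar) (Kw := Kw) (hKw := hKw) (Λe := Λe) (𝔄 := 𝔄) (δ' := δ') (ϖ := ϖ) (hδ' := hδ') (hϖ := hϖ) (𝒵e := 𝒵e)
      (ℬe := ℬe) (𝒢e := 𝒢e) (W𝒱e := W𝒱e) (B₀e := B₀e) (C₄e := C₄e) (a₃e := a₃e) (be := be) (ε₄e := ε₄e) (h𝒢e := h𝒢e)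
      (hWe := hWe) (hB₀e := hB₀e) (hC₄e := hC₄e) (hbe := hbe) (hε₄e := hε₄e) (hdome := hdome) (hselfe := hselfe)
      (hcontre := hcontre) (H₁e := H₁e) (hH₁e := hH₁e) (Te := Te) (rΦe := rΦe) (hTbe := hTbe) (hSre := hSre) (ιe := ιe)
      (hιe := hιe) (He := He) (hHe := hHe) (hqe := hqe) (hRCe := hRCe) (𝔱 := 𝔱) (I := I) (Ef := Ef) (rE := rE) (ee := ee)
      (hrE := hrE) (hEd := hEd) (hEb := hEb) (supp := supp) (hblind := hblind) (ϖP := ϖP) (hdepth := hdepth) (LK := LK)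
      (hK := hK) (hcoupE := hcoupE) (Ω := Ω) (μ := μ) (g := g) (hg := hg) (A := A) (Bd := Bd) (hint := hint) (hpos := hpos)
      (hA := hA) (BE₂ := BE₂) (hElb₂ := hElb₂) (L := L) (𝓡𝒵 := 𝓡𝒵) (𝓡ℬ := 𝓡ℬ) (h𝒢r := h𝒢r) (hWr := hWr) (hιr := hιr)
      (hHr := hHr) (hH₁r := hH₁r) (hTr := hTr) (hRdict := hRdict) (hudict := hudict) (hδ0 := hδ0) (hδ1 := hδ1) (hρ0 := hρ0)
      (hρ := hρ) (hβ := hβ) (η := η) (εθ := εθ) (c₁ := c₁) (c₂ := c₂) (z := z) (hη := hη) (hεθ := hεθ) (hsm := hsm) (a := a)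
      (ha0 := ha0) (hrad := hrad) (Pcore := Pcore) (Pcollar := Pcollar) (hcover := hcover) (hcore := hcore) (hcollar := hcollar)
      (ℓs := fun p => plaqReadOuts Λu η U₀u wu wu' (plq p).1 (plq p).2.1 (plq p).2.2) (κr := η / w₀)
      (hκ := (readOut_constants_nonneg hη.le hw₀ hw₀').1)
      (hℓ := fun p _ => hℓ_plaqReadOuts_matrix Λu η U₀u wu wu' hη.le hU₀u hw₀ hfl _ _ _) (m := 4)
      (hlen := fun p _ => hlen_plaqReadOuts Λu η U₀u wu wu' _ _ _) (κc := 2 * η ^ 2 / w₀' ^ 2)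
      (hκc := (readOut_constants_nonneg hη.le hw₀ hw₀').2)
      (hcurl := fun p _ => hcurl_plaqReadOuts_matrix Λu η U₀u wu wu' hη hw₀' hfl' _ _ _) (hs₁ := hSM.1) (ha := hSM.2.1)
      (hma := hSM.2.2)

end Box

end Summit.QuantumFields.BalabanUV.T4Continuum.ShellMeasureLandauEndAssembledDecayCfLinCoTestsSchurCoarseReadOuts

end
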